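import Summits.AtomisticToContinuum.Crystallization.Theorems.ChartedZeroExcessLayeredLatticeLiouvilleTN

/-!
# Zero-excess layered lattice Liouville — part TO (lens-2 g38): the spine re-entry of the re-typed bond-isomorphism sub-line of part TN —
(HC) `HarmonicContractionPGLms aHi Λ θ s` ⟸ (A0ˣ) `GlobalChartRegistrationPX aHi Λ θ s s'` ∧ the eight consumer pieces of part TD AT TOLERANCE `s'`
(PROVED: part TD's nine-piece glue re-proved verbatim with the two tolerances — (HC)'s conclusion is tolerance-free and its door is the PG door, so the
energy input `HasQuadExcess` of (A0ˣ) is discharged here by `hasQuadExcess_of_isDoorSetPG` = BindingSurface), and the columns `_16XH16` / `_16XH16W`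
(21 leaves): the producers (Z_E) `ExcessChartLocalisationP`, (P) `RegistrationP`, (B1) `WordTransplantP` at `s = 1/100`, the re-typed bond-iso pieces
(G♯ˣ) `GradReframingThickP`, (Λ♭ˣ) `ThinLaunderingPX` at `(s, s') = (1/100, 1/50)`, and every other leaf VERBATIM at `s' = 1/50` as in `_16XH15`.
After the erratum of part TN these replace `_16XH9 … _16XH15` as the columns of the (A0)-line with no refuted leaf.  0 EQUIV; placeholder-free; no
type-class declarations, custom syntax or option pragmas.
-/

noncomputable section

open scoped BigOperators InnerProductSpace RealInnerProductSpace
open MeasureTheory Set Metric Filter Topology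
open Summit.AtomisticToContinuum.Crystallization.Theorems.ChartedPlanarOrderRigidityDoor
  (E3 IsClean IsNash IsCharted IsEStarGSC VisibleGap PertRegime atomsIn siteEnergy eStar BindingSurface)
open Summit.AtomisticToContinuum.Crystallization.Theorems.ChartedPlanarOrderDensityDichotomy (μS IsSep nK nK_nonneg excess)
open Summit.AtomisticToContinuum.Crystallization.Theorems.ChartedPlanarOrderMesoCut (IsDoorSet NearHom LayeredHom EnvClose)
open Summit.AtomisticToContinuum.Crystallization.Theorems.OverbindingBudgetLiouvilleDictionary (NearHomBD)
open Summit.AtomisticToContinuum.Crystallization.Theorems.ChartedPlanarOrderDoorLayered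
  (TwoPeriodic DoorPeriodic PeriodicBulkGapDoor gap_and_pert_1_50_of_periodic NearHomL2BD nearHomL2BD_mono nearHomBD_of_nearHomL2BD
   sq_le_finsum_mem not_nearHomL2BD_singleton envClose_mono Layered layeredHom_eq_layered atomsIn_subset)
open Summit.AtomisticToContinuum.Crystallization.Theorems.ChartedPlanarOrderDoorLayeredOsc (IsTwoShellAffineGood DoorPeriodicOsc)
open Summit.AtomisticToContinuum.Crystallization.Theorems.ChartedPlanarOrderCleanScaleP
  (IsCleanP IsDoorSetP DoorPeriodicP isDoorSetP_mono doorPeriodic_of_doorPeriodicP isDoorSetP_one_iff doorPeriodicP_one_iff)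
open Summit.AtomisticToContinuum.Crystallization.Theorems.ChartedPlanarOrderProfileSlavingLJ (pairForce)
open Literature.MathematicalPhysics.StatisticalMechanics (haggLabel barlowOffset layerNormal IsHaggSeq triangularVec₁ triangularVec₂)


namespace Summit.AtomisticToContinuum.Crystallization.Theorems.ChartedZeroExcessLayeredLatticeLiouville

/-! ## §XVI  (lens-2 g38) (HC)(s) from (A0ˣ)(s,s′) and the consumers at s′ (PROVED); columns `_16XH16` / `_16XH16W` -/

/-- ★★★ **(HC)(s) ⟸ (T) ∧ (U♮)(s′) ∧ (A0ˣ)(s,s′) ∧ (FF) ∧ (E) ∧ (A⁰) ∧ (D⁰) ∧ (C♭) ∧ (R_W) (all at s′) (PROVED)** — part TD's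
`harmonicContractionPGLms_of_nine_pieces` with the registration step replaced by the re-typed node: the multi-scale hypothesis (tolerance `s`) and
BindingSurface's energy input feed (A0ˣ), whose `s′`-chart the eight consumers take; no other change (THIN/FAT split, constants, levels verbatim). [this file, g38] -/
theorem harmonicContractionPGLms_of_nine_pieces_X {aHi Λ θ s s' : ℝ} (hT : TailDominationCert) (hU : UniformTameStability s' Λ)
    (h0 : GlobalChartRegistrationPX aHi Λ θ s s') (hF : TailForceSlavingP aHi Λ θ s') (hE : LipDualLinearisationP aHi Λ θ s')
    (hA : L2HarmonicApproxP aHi Λ θ s') (hD : PositionDecayPL aHi Λ θ s') (hC : PositionCaccioppoliPG aHi Λ θ s')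
    (hW : WildFractionPG aHi Λ θ s') : HarmonicContractionPGLms aHi Λ θ s := by
  intro hL hL' δ hδ a ha c hc
  -- (A0): the registration constant `Cg`; (R_W): the re-registration constant `Cg' ≥ Cg`
  -- the ENERGY input of (A0ˣ): BindingSurface's quadratic excess bound on the PG door (`hasQuadExcess_of_isDoorSetPG`)
  obtain ⟨C₁, hC₁, hQ⟩ := hasQuadExcess_of_isDoorSetPG (δ := δ) hδ
  obtain ⟨Cg, hCg, η0, hη0, R0, hR0, h0'⟩ := h0 δ hδ a ha C₁ hC₁
  have hCg0 : 0 < Cg := zero_lt_one.trans_le hCg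
  obtain ⟨Cg', hCgCg', hW'⟩ := hW δ hδ a ha Cg hCg
  have hCg' : 1 ≤ Cg' := hCg.trans hCgCg'
  -- (C♭), (A⁰), (D⁰), (E): their constants at `Cg'`
  obtain ⟨Cb, hCb, hC'⟩ := hC hT hU δ hδ a ha Cg' hCg'
  obtain ⟨CA, hCA, hA'⟩ := hA hT hU δ hδ a ha Cg' hCg'
  obtain ⟨CD, hCD, ϱD, hϱD, hD'⟩ := hD hT hU hL' δ hδ a ha Cg' hCg' CA hCA
  obtain ⟨Cl, hCl, hE'⟩ := hE δ hδ a ha Cg' hCg'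
  have hCb0 : 0 < Cb := zero_lt_one.trans_le hCb
  have hCD0 : 0 < CD := zero_lt_one.trans_le hCD
  have hCl0 : 0 < Cl := zero_lt_one.trans_le hCl
  -- the contraction ratio `t`, the closeness `ε`, the wild fraction `εw`
  set t : ℝ := min (1 / 128) (c / (3 * Cb * CD + c)) with ht_def
  have ht0 : 0 < t := lt_min (by norm_num) (by positivity)
  have ht128 : t ≤ 1 / 128 := min_le_left _ _
  have ht1 : t ≤ 1 := ht128.trans (by norm_num)
  have hCbCDt : Cb * CD * t ≤ c / 3 := by
    have h1 : t ≤ c / (3 * Cb * CD + c) := min_le_right _ _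
    rw [le_div_iff₀ (by positivity)] at h1
    nlinarith [mul_pos hCb0 hCD0, mul_nonneg hc.le ht0.le]
  have hCbCDt2 : Cb * CD * t ^ 2 ≤ c / 3 := by
    have ht2 : t ^ 2 ≤ t := by nlinarith
    exact (mul_le_mul_of_nonneg_left ht2 (by positivity)).trans hCbCDt
  set ε : ℝ := c * t ^ 5 / (3 * Cb) with hε_def
  have hε : 0 < ε := by positivity
  set εw : ℝ := c * t ^ 3 / (3 * Cb) with hεw_def
  have hεw : 0 < εw := by positivity
  -- (A⁰) at `ε`: the residual tolerance `εr` and a range floor; (FF) at `εf := εr/(2C_ℓ)`: a range floor; the range `ϱ`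
  obtain ⟨εr, hεr, ϱA, hϱA, hA''⟩ := hA' ε hε
  set εf : ℝ := εr / (2 * Cl) with hεf_def
  have hεf : 0 < εf := by positivity
  obtain ⟨ϱF, hϱF, hF'⟩ := hF δ hδ a ha Cg' hCg' εf hεf
  set ϱ : ℝ := max (max ϱA ϱD) (max ϱF 1) with hϱ_def
  have hϱA' : ϱA ≤ ϱ := (le_max_left _ _).trans (le_max_left _ _)
  have hϱD' : ϱD ≤ ϱ := (le_max_right _ _).trans (le_max_left _ _)
  have hϱF' : ϱF ≤ ϱ := (le_max_left _ _).trans (le_max_right _ _)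
  have hϱ1 : 1 ≤ ϱ := (le_max_right _ _).trans (le_max_right _ _)
  -- ceilings and floors of every piece at these constants
  obtain ⟨CE, hCE, ηE, hηE, RE, hRE, hE''⟩ := hE' ϱ hϱ1
  have hCE0 : 0 < CE := zero_lt_one.trans_le hCE
  obtain ⟨ηA, hηA, RA, hRA, hA'''⟩ := hA'' ϱ hϱA'
  obtain ⟨ηD, hηD, RD, hRD, hD''⟩ := hD' ϱ hϱD' t ht0 ht128
  obtain ⟨ηF, hηF, RF, hRF, hF''⟩ := hF' ϱ hϱF'
  obtain ⟨ηb, hηb, Rb, hRb, hC''⟩ := hC' t ht0 ht128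
  obtain ⟨ηW, hηW, RW, hRW, hW''⟩ :=
    hW' εw hεw (tameRadius ^ 2 / (2 * Cg)) (div_pos (pow_pos tameRadius_pos 2) (by positivity))
  -- the extra ceiling making the linearisation residual `≤ εr`
  set ηs : ℝ := (εr / (2 * CE)) ^ 2 with hηs_def
  have hηs : 0 < ηs := by positivity
  refine ⟨t, ht0, ht1, min (min (min η0 ηW) (min ηE ηA)) (min (min ηD ηF) (min ηb ηs)),
    lt_min (lt_min (lt_min hη0 hηW) (lt_min hηE hηA)) (lt_min (lt_min hηD hηF) (lt_min hηb hηs)),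
    max (max (max R0 RW) (max RE RA)) (max (max RD RF) Rb), lt_max_of_lt_left (lt_max_of_lt_left (lt_max_of_lt_left hR0)),
    fun S hSd hg η hη hηle R hR hms => ?_⟩
  have hη0' : η ≤ η0 := hηle.trans ((min_le_left _ _).trans ((min_le_left _ _).trans (min_le_left _ _)))
  have hηW' : η ≤ ηW := hηle.trans ((min_le_left _ _).trans ((min_le_left _ _).trans (min_le_right _ _)))
  have hηE' : η ≤ ηE := hηle.trans ((min_le_left _ _).trans ((min_le_right _ _).trans (min_le_left _ _)))
  have hηA' : η ≤ ηA := hηle.trans ((min_le_left _ _).trans ((min_le_right _ _).trans (min_le_right _ _)))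
  have hηD' : η ≤ ηD := hηle.trans ((min_le_right _ _).trans ((min_le_left _ _).trans (min_le_left _ _)))
  have hηF' : η ≤ ηF := hηle.trans ((min_le_right _ _).trans ((min_le_left _ _).trans (min_le_right _ _)))
  have hηb' : η ≤ ηb := hηle.trans ((min_le_right _ _).trans ((min_le_right _ _).trans (min_le_left _ _)))
  have hηs' : η ≤ ηs := hηle.trans ((min_le_right _ _).trans ((min_le_right _ _).trans (min_le_right _ _)))
  have hR0' : R0 ≤ R := ((le_max_left _ _).trans ((le_max_left _ _).trans (le_max_left _ _))).trans hR
  have hRW' : RW ≤ R := ((le_max_right _ _).trans ((le_max_left _ _).trans (le_max_left _ _))).trans hR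
  have hRE' : RE ≤ R := ((le_max_left _ _).trans ((le_max_right _ _).trans (le_max_left _ _))).trans hR
  have hRA' : RA ≤ R := ((le_max_right _ _).trans ((le_max_right _ _).trans (le_max_left _ _))).trans hR
  have hRD' : RD ≤ R := ((le_max_left _ _).trans ((le_max_left _ _).trans (le_max_right _ _))).trans hR
  have hRF' : RF ≤ R := ((le_max_right _ _).trans ((le_max_left _ _).trans (le_max_right _ _))).trans hR
  have hRb' : Rb ≤ R := ((le_max_right _ _).trans (le_max_right _ _)).trans hR
  have hRpos : 0 < R := hR0.trans_le hR0'
  have hN : 0 ≤ nK (atomsIn (μS S) 0 R) := nK_nonneg _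
  have hfin : (atomsIn (μS S) 0 R).Finite := finite_atomsIn hδ hSd.1.2.1 R
  -- (A0ˣ): one equilibrium `s'`-chart and one global registration at `(Cg, η, R)`, from the `s`-hypothesis and the energy input
  obtain ⟨L, w, hEq, Ψ, hG⟩ := h0' S hSd.1 hg (hQ aHi S hSd) η hη hη0' R hR0' hms
  -- THIN/FAT: a registration at `(Cg', η, R)` whose `ϑ₀`-wild mass is `≤ εw·η·nK(win R)`
  obtain ⟨Ψs, hGs, hWs⟩ : ∃ Ψs : E3 → E3, IsGlobalReg Cg' η R S (LayeredHom (L : E3 →L[ℝ] E3) w) Ψs ∧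
      wildMass tameRadius (atomsIn (μS S) 0 R) Ψs ≤ εw * η * nK (atomsIn (μS S) 0 R) := by
    rcases lt_or_ge (η * nK (atomsIn (μS S) 0 R)) (tameRadius ^ 2 / (2 * Cg)) with hthin | hfat
    · -- THIN window: no wild bond at the tame radius; keep `Ψ`, upgraded to the constant `Cg'`
      refine ⟨Ψ, isGlobalReg_mono hCgCg' hη.le hRpos hG, ?_⟩
      obtain ⟨τ, hτ⟩ := hG.2.2.2 R le_rfl
      have hlev : Cg * (R / R) * η * nK (atomsIn (μS S) 0 R) < tameRadius ^ 2 := by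
        rw [div_self hRpos.ne', mul_one]
        calc Cg * η * nK (atomsIn (μS S) 0 R) = Cg * (η * nK (atomsIn (μS S) 0 R)) := by ring
          _ < Cg * (tameRadius ^ 2 / (2 * Cg)) := mul_lt_mul_of_pos_left hthin hCg0
          _ = tameRadius ^ 2 / 2 := by field_simp
          _ ≤ tameRadius ^ 2 := by linarith [sq_nonneg tameRadius]
      rw [wildMass_eq_zero_of_registered hτ hfin tameRadius_pos hlev]
      exact mul_nonneg (mul_nonneg hεw.le hη.le) hN
    · -- FAT window: (R_W) re-registers at `Cg'`
      exact hW'' S hSd hg η hη hηW' R hRW' L w hEq Ψ hG hfat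
  -- (FF): the tail force is `εf`-dual-small; (E): the linearisation residual is `(C_E√η + C_ℓ·εf)`-, hence `εr`-dual-small
  have hFD := hF'' S hSd.1 hg η hη hηF' R hRF' L w hEq Ψs hGs
  have hres := hE'' S hSd.1 hg η hη hηE' R hRE' L w hEq Ψs hGs εf hεf hFD
  have hsmall : CE * Real.sqrt η + Cl * εf ≤ εr := by
    have hsq : Real.sqrt η ≤ εr / (2 * CE) := by
      calc Real.sqrt η ≤ Real.sqrt ηs := Real.sqrt_le_sqrt hηs'
        _ = εr / (2 * CE) := by rw [hηs_def]; exact Real.sqrt_sq (by positivity)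
    have h1 : CE * Real.sqrt η ≤ εr / 2 := by
      calc CE * Real.sqrt η ≤ CE * (εr / (2 * CE)) := mul_le_mul_of_nonneg_left hsq hCE0.le
        _ = εr / 2 := by field_simp
    have h2 : Cl * εf = εr / 2 := by rw [hεf_def]; field_simp
    linarith
  have hres' := linResidualSmall_mono hsmall hres
  -- (A⁰): the truncated-harmonic approximant `h`, position-close at level `ε`
  obtain ⟨h, hharm, hgrad, hclose⟩ := hA''' S hSd.1 hg η hη hηA' R hRA' L w hEq Ψs hGs hres'
  have hr2 : 2 * t * R ≤ R / 64 := by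
    have h := mul_le_mul_of_nonneg_left ht128 hRpos.le
    linarith
  have hclose2 := hclose (2 * t * R) (by positivity) hr2
  -- (D⁰): an affine-layered Taylor field `T` at the sub-window `win 2tR`
  obtain ⟨T, hTaff, hdec⟩ := hD'' S hSd.1 hg η hη hηD' R hRD' L w hEq Ψs hGs h hharm hgrad
  -- (C♭): position-level Caccioppoli at `t·R`, levels rewritten in units `(tR)²·t³·nK(win R)`
  have e1 : ε * η * R ^ 2 * nK (atomsIn (μS S) 0 R) = ε * η / t ^ 5 * (t * R) ^ 2 * (t ^ 3 * nK (atomsIn (μS S) 0 R)) := by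
    field_simp
  have e2 : CD * t ^ 7 * R ^ 2 * η * nK (atomsIn (μS S) 0 R) = CD * η * t ^ 2 * (t * R) ^ 2 * (t ^ 3 * nK (atomsIn (μS S) 0 R)) := by
    ring
  have e3 : εw * η * nK (atomsIn (μS S) 0 R) = εw * η / t ^ 3 * (t ^ 3 * nK (atomsIn (μS S) 0 R)) := by
    field_simp
  rw [e1] at hclose2
  rw [e2] at hdec
  rw [e3] at hWs
  have hout := hC'' S hSd hg η hη hηb' R hRb' L w hEq Ψs hGs h T hTaff (ε * η / t ^ 5) (CD * η * t ^ 2) (εw * η / t ^ 3)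
    (by positivity) (by positivity) (by positivity) hclose2 hdec hWs
  -- the three levels add up to `≤ c·η`
  have hlev : Cb * (ε * η / t ^ 5 + CD * η * t ^ 2 + εw * η / t ^ 3) ≤ c * η := by
    have f1 : Cb * (ε * η / t ^ 5) = c * η / 3 := by rw [hε_def]; field_simp
    have f2 : Cb * (εw * η / t ^ 3) = c * η / 3 := by rw [hεw_def]; field_simp
    have f3 : Cb * (CD * η * t ^ 2) ≤ c * η / 3 := by
      calc Cb * (CD * η * t ^ 2) = Cb * CD * t ^ 2 * η := by ring
        _ ≤ c / 3 * η := mul_le_mul_of_nonneg_right hCbCDt2 hη.le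
        _ = c * η / 3 := by ring
    calc Cb * (ε * η / t ^ 5 + CD * η * t ^ 2 + εw * η / t ^ 3)
        = Cb * (ε * η / t ^ 5) + Cb * (CD * η * t ^ 2) + Cb * (εw * η / t ^ 3) := by ring
      _ ≤ c * η / 3 + c * η / 3 + c * η / 3 := by linarith
      _ = c * η := by ring
  exact nearHomL2BD_mono hlev hout

/-- ★★ **H♭^ℓ,ms(s) ⟸ (P)(s) ∧ (T) ∧ (U♮)(s′) ∧ (A0ˣ)(s,s′) ∧ (FF) ∧ (E) ∧ (A⁰) ∧ (D⁰) ∧ (C♭) ∧ (R_W) (PROVED)**. [this file, g38] -/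
theorem halvingBasinPGLms_of_ten_pieces_X {aHi Λ θ s s' : ℝ} (hP : RegistrationP aHi Λ θ s) (hT : TailDominationCert)
    (hU : UniformTameStability s' Λ) (h0 : GlobalChartRegistrationPX aHi Λ θ s s') (hF : TailForceSlavingP aHi Λ θ s')
    (hE : LipDualLinearisationP aHi Λ θ s') (hA : L2HarmonicApproxP aHi Λ θ s') (hD : PositionDecayPL aHi Λ θ s')
    (hC : PositionCaccioppoliPG aHi Λ θ s') (hW : WildFractionPG aHi Λ θ s') : HalvingBasinPGLms aHi Λ θ s :=
  halvingBasinPGLms_of_reg_contr hP (harmonicContractionPGLms_of_nine_pieces_X hT hU h0 hF hE hA hD hC hW)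

/-- ★★ **COLUMN `_16XHlms` at a general producer tolerance `s`** (part T's `gap_and_pert_1_50_of_certs_16XHlms` with the literal `1/50` generalised —
the seams `conformalChartLocalisationPG_of_excess`, `halvingBasinPGms_of_confL` are tolerance-polymorphic). [this file, g38] -/
theorem gap_and_pert_1_50_of_certs_16XHlms_tol {s : ℝ} (hL : LatticeLiouvilleCert) (hL' : LayeredLiouvilleCert)
    (hR : OscRigidityL2BDPG 1 2 (1 / 16) (1 / 16)) (hX : ExcessFlatnessControlP 1 2 (1 / 16) (1 / 16))
    (hE : ExcessChartLocalisationP 1 2 (1 / 16) s) (hB : HalvingBasinPGLms 1 2 (1 / 16) s)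
    (hG : PeriodicBulkGapDoor 2) : VisibleGap (1 / 50) ∧ PertRegime (1 / 50) :=
  gap_and_pert_1_50_of_certs_16XBGms hL hL' hR hX (halvingBasinPGms_of_confL (conformalChartLocalisationPG_of_excess hE) hB) hG

/-- ★★★ **COLUMN `_16XH16` — TWENTY-ONE opaque leaves, NO REFUTED LEAF** (the (A0)-line after the erratum of part TN): `LatticeLiouvilleCert →
LayeredLiouvilleCert → R_G → X → Z_E(1/100) → P(1/100) → T → U♮ → B1(1/100) → G♯ˣ → Λ♭ˣ → Υc → Υb → A0♯⁺ → FF → E → A⁰ → D⁰ → C♭ → R_W →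
PeriodicBulkGapDoor 2 → VisibleGap (1/50) ∧ PertRegime (1/50)`; `(aHi; Λ, θ) = (1; 2, 1/16)`; producer tolerance `s = 1/100`, re-typed bond-iso pieces at
`(s, s′) = (1/100, 1/50)`, every consumer at `s′ = 1/50`.  Open leaves on the (A0)-line: (B1)(1/100) [XL], (G♯ˣ) [L], (Λ♭ˣ) [L], (Υc) [M], (Υb) [S],
(A0♯⁺) [L]; producers (Z_E)(1/100), (P)(1/100) (UNDECIDED, as at 1/50). [this file, g38] -/
theorem gap_and_pert_1_50_of_certs_16XH16 (hL : LatticeLiouvilleCert) (hL' : LayeredLiouvilleCert)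
    (hR : OscRigidityL2BDPG 1 2 (1 / 16) (1 / 16)) (hX : ExcessFlatnessControlP 1 2 (1 / 16) (1 / 16))
    (hE : ExcessChartLocalisationP 1 2 (1 / 16) (1 / 100)) (hP : RegistrationP 1 2 (1 / 16) (1 / 100))
    (hT : TailDominationCert) (hU : UniformTameStability (1 / 50) 2)
    (h1 : WordTransplantP 1 2 (1 / 16) (1 / 100)) (hGT : GradReframingThickP 1 2 (1 / 16) (1 / 100) (1 / 50))
    (hGl : ThinLaunderingPX 1 2 (1 / 16) (1 / 100) (1 / 50))
    (hUc : UntwistCollarP 1 2 (1 / 16) (1 / 50)) (hUb : UntwistBookkeepingP 1 2 (1 / 50))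
    (hl : BondIsoLevelsP 1 2 (1 / 16) (1 / 50))
    (hF : TailForceSlavingP 1 2 (1 / 16) (1 / 50))
    (hE' : LipDualLinearisationP 1 2 (1 / 16) (1 / 50)) (hA : L2HarmonicApproxP 1 2 (1 / 16) (1 / 50))
    (hD : PositionDecayPL 1 2 (1 / 16) (1 / 50)) (hC : PositionCaccioppoliPG 1 2 (1 / 16) (1 / 50))
    (hW : WildFractionPG 1 2 (1 / 16) (1 / 50)) (hG : PeriodicBulkGapDoor 2) : VisibleGap (1 / 50) ∧ PertRegime (1 / 50) :=
  gap_and_pert_1_50_of_certs_16XHlms_tol hL hL' hR hX hE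
    (halvingBasinPGLms_of_ten_pieces_X hP hT hU
      (globalChartRegistrationPX_of_subline (by norm_num) h1 hGT hGl (lateralUntwistP_of_collar_book hUc hUb) hl) hF hE' hA hD hC hW) hG

/-- ★ **COLUMN `_16XH16W`** — the same with (A1) «WildReRegistrationPG» in place of (R_W). [this file, g38] -/
theorem gap_and_pert_1_50_of_certs_16XH16W (hL : LatticeLiouvilleCert) (hL' : LayeredLiouvilleCert)
    (hR : OscRigidityL2BDPG 1 2 (1 / 16) (1 / 16)) (hX : ExcessFlatnessControlP 1 2 (1 / 16) (1 / 16))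
    (hE : ExcessChartLocalisationP 1 2 (1 / 16) (1 / 100)) (hP : RegistrationP 1 2 (1 / 16) (1 / 100))
    (hT : TailDominationCert) (hU : UniformTameStability (1 / 50) 2)
    (h1 : WordTransplantP 1 2 (1 / 16) (1 / 100)) (hGT : GradReframingThickP 1 2 (1 / 16) (1 / 100) (1 / 50))
    (hGl : ThinLaunderingPX 1 2 (1 / 16) (1 / 100) (1 / 50))
    (hUc : UntwistCollarP 1 2 (1 / 16) (1 / 50)) (hUb : UntwistBookkeepingP 1 2 (1 / 50))
    (hl : BondIsoLevelsP 1 2 (1 / 16) (1 / 50))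
    (hF : TailForceSlavingP 1 2 (1 / 16) (1 / 50))
    (hE' : LipDualLinearisationP 1 2 (1 / 16) (1 / 50)) (hA : L2HarmonicApproxP 1 2 (1 / 16) (1 / 50))
    (hD : PositionDecayPL 1 2 (1 / 16) (1 / 50)) (hC : PositionCaccioppoliPG 1 2 (1 / 16) (1 / 50))
    (hw : WildReRegistrationPG 1 2 (1 / 16) (1 / 50)) (hG : PeriodicBulkGapDoor 2) : VisibleGap (1 / 50) ∧ PertRegime (1 / 50) :=
  gap_and_pert_1_50_of_certs_16XH16 hL hL' hR hX hE hP hT hU h1 hGT hGl hUc hUb hl hF hE' hA hD hC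
    (wildFractionPG_of_wildReRegistrationPG hw) hG

/-- ★ **nothing lost at the column level**: the SURVIVING P-door node (A0)(1/50) with the producers at `1/100` runs the same spine
(`globalChartRegistrationPX_of_globalChartRegistrationP`). [this file, g38] -/
theorem gap_and_pert_1_50_of_certs_16XH16A0 (hL : LatticeLiouvilleCert) (hL' : LayeredLiouvilleCert)
    (hR : OscRigidityL2BDPG 1 2 (1 / 16) (1 / 16)) (hX : ExcessFlatnessControlP 1 2 (1 / 16) (1 / 16))
    (hE : ExcessChartLocalisationP 1 2 (1 / 16) (1 / 100)) (hP : RegistrationP 1 2 (1 / 16) (1 / 100))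
    (hT : TailDominationCert) (hU : UniformTameStability (1 / 50) 2)
    (h0 : GlobalChartRegistrationP 1 2 (1 / 16) (1 / 50))
    (hF : TailForceSlavingP 1 2 (1 / 16) (1 / 50))
    (hE' : LipDualLinearisationP 1 2 (1 / 16) (1 / 50)) (hA : L2HarmonicApproxP 1 2 (1 / 16) (1 / 50))
    (hD : PositionDecayPL 1 2 (1 / 16) (1 / 50)) (hC : PositionCaccioppoliPG 1 2 (1 / 16) (1 / 50))
    (hW : WildFractionPG 1 2 (1 / 16) (1 / 50)) (hG : PeriodicBulkGapDoor 2) : VisibleGap (1 / 50) ∧ PertRegime (1 / 50) :=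
  gap_and_pert_1_50_of_certs_16XHlms_tol hL hL' hR hX hE
    (halvingBasinPGLms_of_ten_pieces_X hP hT hU (globalChartRegistrationPX_of_globalChartRegistrationP (by norm_num) h0) hF hE' hA hD hC hW) hG

end Summit.AtomisticToContinuum.Crystallization.Theorems.ChartedZeroExcessLayeredLatticeLiouville

end
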